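/-
COR-CM (cell pub-hodgecm2, stage 2 of the Hodge ladder) — Δ2 BRIDGE, (c)+(d) closure at ι₁ («WORLD = C» FINAL; ASSEMBLER MODULE TABLE v1.2
«ι₁ ∕ Id CHAIN», row I5 part B): the J2 interface `ComponentAlbaneseId` INHABITED AS A TERM at instance `ι₁` over the UNTWISTED §4.2 datum
(instlevel-a's `sec42DataIdOfFourLe ∕ sec42DataIdOf`), from part A's component morphisms `Iota1.componentInjId` (cofan along `ι₁`).
= prove-5 g0's ✔ `ComponentAlbanesePin.lean` + `ComponentAlbanesePinLaw.lean` with the token map `componentInj ↦ componentInjId`,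
`[Algebra L ℂ] (hι : algebraMap ∘ c = ι₁) ↦ letI := ι₁.toAlgebra`, `sec42DataOf* ↦ sec42DataIdOf*`, `compactifiedOf ↦ compactifiedIdOf`,
`honestP5Of ↦ honestP5IdOf`, `ComponentAlbanese ↦ ComponentAlbaneseId`; no `starRingEnd`, no `cmConjRingHom`.  Seat
prover-pub-hodgecm2-d2bridge-prove-5-g1-0 («b» draft for pin-a's row I5; one filer).  Explicit per-declaration binders; no `sorry`.
FRAMING: HC_CM is NOT proved; «Δ2 BRIDGE CLOSED» is NOT claimed.
-/
import Summits.HodgeConjecture.CorCM.D2Bridge.Iota1.ShimuraComponentInj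
import Summits.HodgeConjecture.CorCM.D2Bridge.Iota1.ComponentAlbanese
import Summits.HodgeConjecture.CorCM.B01.Transposition.HComp.HeckeTranslatesIdOf
import Summits.HodgeConjecture.CorCM.D2Bridge.AlbaneseOnPieceFunctorial
import Summits.HodgeConjecture.CorCM.D2Bridge.AlbaneseOnPieceDetects
import Summits.HodgeConjecture.CorCM.D2Bridge.HcmS3AlbaneseBetti
import HarnessLib


/-!
# Δ2 bridge, J-record pin: `ComponentAlbanese` INHABITED at the pin

For the model's tower over `(L, ι₁, V)` (`4 ≤ [L:ℚ]`), Liu's §4.2 datum `C := Model.sec42DataIdOfFourLe h ⟨V.Hm,…⟩ Φ h4 iso` over the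
honest Prop.-C.5 system (levels `K ⊆ K_f(3)`, `X_K = M_K ⊗_{L,c} L`, `A_K = Alb_{X_K}`, transitions `C.Atr`) and its Hecke translates
`T := Model.sec42DataIdOfFourLe_heckeTranslates hU7 h …`:

* `pull_albOnPiece_componentInjId_rel ∕ _Atr ∕ _albTr` — LAWS (ii) (tower relation `Rel`), (iii) (level transitions `Alb(u)`),
  (iv) (Hecke translates `Alb(T_g)`) ON `H¹`, for `alb K h := albOnPiece (C.alb K) (componentInj K h) (basePt K h)`: the component laws
  `componentInj_rel ∕ _comp_map ∕ _comp_tr` (ON THE NOSE, part A) fed to the core's functoriality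
  `pull_albOnPiece_reparam ∕ _comp_baseChange_Atr ∕ _comp_baseChange_albTr`.
* `exists_pull_albOnPiece_componentInjId_ne_zero` — LAW (v′), detection of non-zero `E`-homomorphisms `φ : A_K → B` on `H¹` by some
  component (prove-3's `exists_pull_albOnPiece_baseChange_ne_zero'` on the cofan `exists_isColimit_componentInj`; [Liu2021] Lemma 2.4 (1)
  per piece = S3 `bijective_pull_abelJacobi_pms`).
* `nonempty_componentAlbanesePin` — **the interface `ComponentAlbaneseId hHD hI hU h₃ hA V h Φ C T` is inhabited** (`Γof K := levelOf V K`).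
* `nonempty_componentAlbanesePinTotalId` — the same at the TOTAL carrier `Model.sec42DataIdOf h iso …` ∕ `Model.sec42DataIdOf_heckeTranslates`
  (`ComponentAlbanese.transport` along `Model.sec42DataIdOf_eq_of_four_le`, a `dif_pos`).

HC_CM is NOT proved; nothing here is a display or a pointer move.
-/

set_option autoImplicit false

noncomputable section

open Function CategoryTheory CategoryTheory.Limits AlgebraicGeometry NumberField
open Literature.AlgebraicGeometry.Motives
open Literature.AlgebraicGeometry.HodgeTheory
open Literature.AlgebraicGeometry.ShimuraVarieties
open Literature.AlgebraicGeometry.ShimuraVarieties.UnitaryCanonicalModel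
open Literature.NumberTheory.Automorphic Literature.NumberTheory.Automorphic.PicardCM
open Literature.NumberTheory.Automorphic.Liu2021 Literature.NumberTheory.Automorphic.Liu2021.AppendixC
open Literature.NumberTheory.Transcendental (Arapura2012_Cor_15_4_6)
open Summit.HodgeConjecture.CorCM.Model Summit.HodgeConjecture.CorCM.HComp
open HodgeCM.Model HodgeCM.Model.LevelTranslate HodgeCM.Model.TowerLevel

namespace Summit.HodgeConjecture.CorCM.D2Bridge.Iota1

open Summit.HodgeConjecture.CorCM.D2Bridge
open AbelianVariety (bcFunctor)

variable {L : HodgeCM.CMField} {ι₁ : L →+* ℂ}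

/-! ## §1 LAWS (ii)–(iv) on `H¹` for `albOnPiece (C.alb K) (componentInj K h) (basePt K h)` -/

/-- **LAW (ii) on `Hⁱ` — the tower relation**: for `Rel Γ_K γ h h'`,
`((α_K)|_{P_h})^* = t_γ^* ∘ ((α_K)|_{P_{h'}})^*` on `Hⁱ((A_K ⊗ ℂ)(ℂ); ℚ)` (`componentInj_rel`: both indices name the SAME component,
identified by `z ↦ γz`; the core's re-parametrisation law). [cite: Liu2021, proof of Lemma 2.4 (1) (l. 1220–1228)] [cite: Deligne1979ShimuraVarieties, §2.1.2] -/
theorem pull_albOnPiece_componentInjId_rel (V : HodgeCM.HermSpace3 L ι₁) (hU : BallQuotientUniformisedDatum)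
    (h₃ : CMAbelianVarietyRealised) (h4 : 4 ≤ Module.finrank ℚ L) (h : exists_recordSystem) (hHD : exists_isReal_hodgeModel)
    (hA : Arapura2012_Cor_15_4_6) (Φ : CMType (pkgF L))
    (iso : ℕ → Prop) (K : C5.SmallLevel (K3 (pkgV V))) {hh hh' : V.adelicFin} {γ : ↥(Urat V)} (r : Rel (levelOf V K) γ hh hh')
    (i : ℕ) :
    letI : Algebra (L : Type) ℂ := ι₁.toAlgebra
    haveI := geometricallyIrreducible_pms hU h₃ (code V K hh)
    haveI := geometricallyIrreducible_pms hU h₃ (code V K hh')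
    BettiUniverse.pull (albOnPiece ((sec42DataIdOfFourLe h (pkgV V) Φ h4 iso).alb K) (componentInjId V hU h₃ h4 h hHD K hh)
        (basePt V hU h₃ K hh)) i =
      BettiUniverse.pull (transMor hU h₃ hHD hA γ.2 ((levelOf V K).conj hh (belowConjThree_levelOf V K))
          ((levelOf V K).conj hh' (belowConjThree_levelOf V K)) (transCond_of_rel (belowConjThree_levelOf V K) r)) i ∘ₗ
        BettiUniverse.pull (albOnPiece ((sec42DataIdOfFourLe h (pkgV V) Φ h4 iso).alb K) (componentInjId V hU h₃ h4 h hHD K hh')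
          (basePt V hU h₃ K hh')) i := by
  letI : Algebra (L : Type) ℂ := ι₁.toAlgebra
  exact pull_albOnPiece_reparam ((sec42DataIdOfFourLe h (pkgV V) Φ h4 iso).alb K) (componentInjId V hU h₃ h4 h hHD K hh')
    (componentInjId V hU h₃ h4 h hHD K hh) _ (isSmoothProjective_P V hU h₃ K hh') (isSmoothProjective_P V hU h₃ K hh)
    (componentInjId_rel V hU h₃ h4 h hHD hA K r).symm _ _ i

/-- **LAW (iii) on `Hⁱ` — level transitions**: for `K' ⊆ K` (`f : K' ⟶ K`) and Liu's `Alb(u^{K'}_K) = C.Atr f : A_{K'} → A_K`: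
`((α_{K'})|_{P'_h})^* ∘ (Alb u)_ℂ^* = t_1^* ∘ ((α_K)|_{P_h})^*` (`componentInj_comp_map` fed to the core's transition square).
[cite: Liu2021, §4.2 l. 2062–2074 and Def. 2.3 (l. 1207)] -/
theorem pull_albOnPiece_componentInjId_Atr (V : HodgeCM.HermSpace3 L ι₁) (hU : BallQuotientUniformisedDatum)
    (h₃ : CMAbelianVarietyRealised) (h4 : 4 ≤ Module.finrank ℚ L) (h : exists_recordSystem) (hHD : exists_isReal_hodgeModel)
    (hA : Arapura2012_Cor_15_4_6) (Φ : CMType (pkgF L))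
    (iso : ℕ → Prop) {K K' : C5.SmallLevel (K3 (pkgV V))} (f : K' ⟶ K) (hh : V.adelicFin) (i : ℕ) :
    letI : Algebra (L : Type) ℂ := ι₁.toAlgebra
    haveI := geometricallyIrreducible_pms hU h₃ (code V K hh)
    haveI := geometricallyIrreducible_pms hU h₃ (code V K' hh)
    BettiUniverse.pull (albOnPiece ((sec42DataIdOfFourLe h (pkgV V) Φ h4 iso).alb K') (componentInjId V hU h₃ h4 h hHD K' hh)
          (basePt V hU h₃ K' hh)) i ∘ₗ
        BettiUniverse.pull (AbelianVariety.Hom.baseChange ℂ ((sec42DataIdOfFourLe h (pkgV V) Φ h4 iso).Atr f)).hom.hom.hom i =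
      BettiUniverse.pull (transMor hU h₃ hHD hA (Subgroup.one_mem (Urat V)) ((levelOf V K').conj hh (belowConjThree_levelOf V K'))
          ((levelOf V K).conj hh (belowConjThree_levelOf V K))
          (transCond_conj_of_le (levelOf_mono V f.le) (belowConjThree_levelOf V K) (belowConjThree_levelOf V K') hh)) i ∘ₗ
        BettiUniverse.pull (albOnPiece ((sec42DataIdOfFourLe h (pkgV V) Φ h4 iso).alb K) (componentInjId V hU h₃ h4 h hHD K hh)
          (basePt V hU h₃ K hh)) i := by
  letI : Algebra (L : Type) ℂ := ι₁.toAlgebra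
  exact pull_albOnPiece_comp_baseChange_Atr (sec42DataIdOfFourLe h (pkgV V) Φ h4 iso) (componentInjId V hU h₃ h4 h hHD K hh)
    (componentInjId V hU h₃ h4 h hHD K' hh) _ (isSmoothProjective_P V hU h₃ K hh) (isSmoothProjective_P V hU h₃ K' hh) f
    (componentInjId_comp_map V hU h₃ h4 h hHD hA f hh).symm _ _ i

/-- **LAW (iv) on `Hⁱ` — Hecke translates**: for `g⁻¹K₁g ⊆ K` and Liu's `Alb(T_g) = T.albTr g K₁ K : A_{K₁} → A_K` of the translates
`T := Model.sec42DataIdOfFourLe_heckeTranslates hU7 h …` (§4.2 l. 2074 «the Hecke correspondences provide a homomorphism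
`𝔾(𝔸_F^∞) → Aut_E(A_∞)`»): `((α_{K₁})|_{P_h})^* ∘ (Alb T_g)_ℂ^* = t_1^* ∘ ((α_K)|_{P_{hg}})^*` (`componentInj_comp_tr` fed to the core's
Hecke square). [cite: Liu2021, §4.2 l. 2070–2074] [cite: Milne2005ShimuraVarieties, §13 p. 118 L21–26 and Thm. 13.6] -/
theorem pull_albOnPiece_componentInjId_albTr (V : HodgeCM.HermSpace3 L ι₁) (hU : BallQuotientUniformisedDatum)
    (h₃ : CMAbelianVarietyRealised) (h4 : 4 ≤ Module.finrank ℚ L) (h : exists_recordSystem) (hHD : exists_isReal_hodgeModel)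
    (hA : Arapura2012_Cor_15_4_6)
    (hU7 : heckeTranslate_definedOver) (Φ : CMType (pkgF L)) (iso : ℕ → Prop) {K₁ K : C5.SmallLevel (K3 (pkgV V))}
    (g : V.adelicFin) (hle : C5.HeckeLE g K₁ K) (hh : V.adelicFin) (i : ℕ) :
    letI : Algebra (L : Type) ℂ := ι₁.toAlgebra
    haveI := geometricallyIrreducible_pms hU h₃ (code V K₁ hh)
    haveI := geometricallyIrreducible_pms hU h₃ (code V K (hh * g))
    BettiUniverse.pull (albOnPiece ((sec42DataIdOfFourLe h (pkgV V) Φ h4 iso).alb K₁) (componentInjId V hU h₃ h4 h hHD K₁ hh)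
          (basePt V hU h₃ K₁ hh)) i ∘ₗ
        BettiUniverse.pull (AbelianVariety.Hom.baseChange ℂ
          ((sec42DataIdOfFourLe_heckeTranslates hU7 h (pkgV V) Φ h4 iso).albTr g K₁ K hle)).hom.hom.hom i =
      BettiUniverse.pull (transMor hU h₃ hHD hA (Subgroup.one_mem (Urat V)) ((levelOf V K₁).conj hh (belowConjThree_levelOf V K₁))
          ((levelOf V K).conj (hh * g) (belowConjThree_levelOf V K)) (transCond_conj_mul_of_heckeLE V hle hh)) i ∘ₗ
        BettiUniverse.pull (albOnPiece ((sec42DataIdOfFourLe h (pkgV V) Φ h4 iso).alb K) (componentInjId V hU h₃ h4 h hHD K (hh * g))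
          (basePt V hU h₃ K (hh * g))) i := by
  letI : Algebra (L : Type) ℂ := ι₁.toAlgebra
  exact pull_albOnPiece_comp_baseChange_albTr (sec42DataIdOfFourLe h (pkgV V) Φ h4 iso) (componentInjId V hU h₃ h4 h hHD K₁ hh)
    (componentInjId V hU h₃ h4 h hHD K (hh * g)) (isSmoothProjective_P V hU h₃ K₁ hh) (isSmoothProjective_P V hU h₃ K (hh * g))
    (sec42DataIdOfFourLe_heckeTranslates hU7 h (pkgV V) Φ h4 iso) g hle _
    (componentInjId_comp_recordFunctorHeckeTranslate V hU h₃ h4 h hHD hA hU7 g hle hh).symm _ _ i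

/-! ## §2 LAW (v′): detection on `H¹` -/

/-- **LAW (v′) — detection**: a non-zero `E`-homomorphism `φ : A_K → B` has a component `h` with
`((α_K)|_{P_{Γ_K.conj h}} ≫ φ_ℂ)^* ≠ 0` on `H¹(B(ℂ); ℚ)` ([Liu2021] proof of Thm. 4.18, l. 2248–2250 «by pulling back … we obtain an
injective map»; Lemma 2.4 (1) per piece).  Prove-3's `exists_pull_albOnPiece_baseChange_ne_zero'` (cover of `(∇X_K)_ℂ` by the
`P × P`, faithfulness of `H¹`) on the coproduct cofan of components `exists_isColimit_componentInj`, `(f^P)^*` injective by S3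
`bijective_pull_abelJacobi_pms`. [cite: Liu2021, proof of Thm. 4.18 (FJcycle.tex l. 2248–2250) and Lemma 2.4 (1) (l. 1213, proof l. 1220–1228)] -/
theorem exists_pull_albOnPiece_componentInjId_ne_zero (V : HodgeCM.HermSpace3 L ι₁) (hU : BallQuotientUniformisedDatum)
    (h₃ : CMAbelianVarietyRealised) (h4 : 4 ≤ Module.finrank ℚ L) (h : exists_recordSystem) (hHD : exists_isReal_hodgeModel)
    (Φ : CMType (pkgF L)) (iso : ℕ → Prop)
    (K : C5.SmallLevel (K3 (pkgV V))) {B : AbelianVariety (pkgF L)} (φ : (sec42DataIdOfFourLe h (pkgV V) Φ h4 iso).A K ⟶ B)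
    (hφ : φ ≠ 0) :
    letI : Algebra (L : Type) ℂ := ι₁.toAlgebra
    ∃ hh : V.adelicFin,
      haveI := geometricallyIrreducible_pms hU h₃ (code V K hh)
      BettiUniverse.pull (albOnPiece ((sec42DataIdOfFourLe h (pkgV V) Φ h4 iso).alb K) (componentInjId V hU h₃ h4 h hHD K hh)
          (basePt V hU h₃ K hh) ≫ (AbelianVariety.Hom.baseChange ℂ φ).hom.hom.hom) 1 ≠ 0 := by
  classical
  letI : Algebra (L : Type) ℂ := ι₁.toAlgebra
  obtain ⟨Ξ, _, g, ⟨hcol⟩⟩ := exists_isColimit_componentInjId V hU h₃ h4 h hHD K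
  haveI : ∀ q, GeometricallyIrreducible (P V hU h₃ K (g q)).hom := fun q => geometricallyIrreducible_pms hU h₃ _
  haveI := (compactifiedIdOf h (pkgV V) Φ h4).smooth_X K
  have h𝒥 : ∀ q, Nonempty (Jacobian (P V hU h₃ K (g q))) := fun q =>
    nonempty_jacobian_of_isSmoothProjective_complex_of_dim _ (isSmoothProjective_P V hU h₃ K (g q))
  obtain ⟨q, hq⟩ := exists_pull_albOnPiece_baseChange_ne_zero' (d := (honestP5IdOf h (pkgF L) ι₁ (pkgV V) Φ).n - 1)
    (X := (compactifiedIdOf h (pkgV V) Φ h4).X.obj K) ((compactifiedIdOf h (pkgV V) Φ h4).projective_X K)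
    ((sec42DataIdOfFourLe h (pkgV V) Φ h4 iso).alb K) (fun q => componentInjId V hU h₃ h4 h hHD K (g q)) hcol
    (fun q => (h𝒥 q).some) (fun q => basePt V hU h₃ K (g q))
    (fun q => (bijective_pull_abelJacobi_pms (code V K (g q))
      (isAnisotropic_of_four_le V h4 ((levelOf V K).conj (g q) (belowConjThree_levelOf V K))) (h𝒥 q).some
      (basePt V hU h₃ K (g q))).1) φ hφ
  exact ⟨g q, hq⟩

/-! ## §3 The interface, inhabited -/

/-- **The J2 interface of the J-record pin, INHABITED** at Liu's explicit §4.2 carrier over the honest datum and its Hecke translates: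
`Γof K := levelOf V K` (`(U(L⁺) ∩ K, K)`), `alb K h := albOnPiece (C.alb K) (componentInj K h) (basePt K h)`, the laws (ii)–(iv), (v′)
of §1–§2 (`U.pull (transMorU …) = BettiUniverse.pull (transMor …)`, `Model.universeOf_pull`).
[cite: Liu2021, proof of Lemma 2.4 (1) (FJcycle.tex l. 1220–1228); §4.2 l. 2062–2074] [cite: Deligne1979ShimuraVarieties, §2.1.2] -/
theorem nonempty_componentAlbanesePinId (hHD : exists_isReal_hodgeModel) (hI : hodgePQ_independent_of_hodgeModel)
    (hU : BallQuotientUniformisedDatum) (h₃ : CMAbelianVarietyRealised) (hA : Arapura2012_Cor_15_4_6)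
    (hU7 : heckeTranslate_definedOver) (V : HodgeCM.HermSpace3 L ι₁) (h : exists_recordSystem) (h4 : 4 ≤ Module.finrank ℚ L)
    (Φ : CMType (pkgF L)) (iso : ℕ → Prop) :
    letI : Algebra (L : Type) ℂ := ι₁.toAlgebra
    Nonempty (ComponentAlbaneseId hHD hI hU h₃ hA V h Φ (sec42DataIdOfFourLe h (pkgV V) Φ h4 iso)
      (sec42DataIdOfFourLe_heckeTranslates hU7 h (pkgV V) Φ h4 iso)) := by
  letI : Algebra (L : Type) ℂ := ι₁.toAlgebra
  exact ⟨
    { Γof := levelOf V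
      belowConjThree := belowConjThree_levelOf V
      Γof_mono := fun hle => levelOf_mono V hle
      Γof_hecke := fun _ _ _ hle => levelOf_le_conj_of_heckeLE V hle
      alb := fun K hh =>
        haveI := geometricallyIrreducible_pms hU h₃ (code V K hh)
        albOnPiece ((sec42DataIdOfFourLe h (pkgV V) Φ h4 iso).alb K) (componentInjId V hU h₃ h4 h hHD K hh) (basePt V hU h₃ K hh)
      pull_alb_rel := fun K _ _ _ r => by
        rw [HodgeCM.Model.universeOf_pull]
        exact pull_albOnPiece_componentInjId_rel V hU h₃ h4 h hHD hA Φ iso K r 1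
      pull_alb_Atr := fun f hh => by
        rw [HodgeCM.Model.universeOf_pull]
        exact pull_albOnPiece_componentInjId_Atr V hU h₃ h4 h hHD hA Φ iso f hh 1
      pull_alb_albTr := fun g _ _ hK hh => by
        rw [HodgeCM.Model.universeOf_pull]
        exact pull_albOnPiece_componentInjId_albTr V hU h₃ h4 h hHD hA hU7 Φ iso g hK hh 1
      alb_detect := fun K _ φ hφ =>
        exists_pull_albOnPiece_componentInjId_ne_zero V hU h₃ h4 h hHD Φ iso K φ hφ }⟩

/-- **The J2 interface at the TOTAL carrier `C := Model.sec42DataIdOf h iso` of the END displays**, `T := Model.sec42DataIdOf_heckeTranslates`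
(which is DEFINED as the cast of the explicit translates along `Model.sec42DataIdOf_eq_of_four_le`): `ComponentAlbanese.transport`.
[cite: Liu2021, §4.2 l. 2053–2074] -/
theorem nonempty_componentAlbanesePinTotalId (hHD : exists_isReal_hodgeModel) (hI : hodgePQ_independent_of_hodgeModel)
    (hU : BallQuotientUniformisedDatum) (h₃ : CMAbelianVarietyRealised) (hA : Arapura2012_Cor_15_4_6)
    (hU7 : heckeTranslate_definedOver) (V : HodgeCM.HermSpace3 L ι₁) (h : exists_recordSystem) (h4 : 4 ≤ Module.finrank ℚ L)
    (Φ : CMType (pkgF L))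
    (iso : ∀ (F : Summit.HodgeConjecture.CorCM.CMField) (ι : F →+* ℂ) (_ : Summit.HodgeConjecture.CorCM.HermSpace3 F ι)
      (_ : CMType F), ℕ → Prop) :
    letI : Algebra (L : Type) ℂ := ι₁.toAlgebra
    Nonempty (ComponentAlbaneseId hHD hI hU h₃ hA V h Φ (sec42DataIdOf h iso (pkgF L) ι₁ (pkgV V) Φ)
      (sec42DataIdOf_heckeTranslates hU7 h (pkgV V) Φ iso h4)) := by
  letI : Algebra (L : Type) ℂ := ι₁.toAlgebra
  exact ⟨(Classical.choice (nonempty_componentAlbanesePinId hHD hI hU h₃ hA hU7 V h h4 Φ (iso (pkgF L) ι₁ (pkgV V) Φ))).transport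
    (sec42DataIdOf_eq_of_four_le h (pkgV V) Φ iso h4).symm⟩


/-! ## §4 The J2 interface AS A TERM with its level law (twin of `ComponentAlbanesePinLaw.lean`) -/



/-- **The J2 interface value AS A TERM** at Liu's explicit §4.2 carrier `Model.sec42DataIdOfFourLe` and its Hecke translates — the
witness of `nonempty_componentAlbanesePin`: `Γof := levelOf V`, `alb K h := albOnPiece (C.alb K) (componentInj K h) (basePt K h)`,
laws (ii)–(iv), (v′) from `ComponentAlbanesePin.lean`. [cite: Liu2021, proof of Lemma 2.4 (1) (FJcycle.tex l. 1220–1228); §4.2 l. 2062–2074] [cite: Deligne1979ShimuraVarieties, §2.1.2] -/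
def componentAlbanesePinId (hHD : exists_isReal_hodgeModel) (hI : hodgePQ_independent_of_hodgeModel)
    (hU : BallQuotientUniformisedDatum) (h₃ : CMAbelianVarietyRealised) (hA : Arapura2012_Cor_15_4_6)
    (hU7 : heckeTranslate_definedOver) (V : HodgeCM.HermSpace3 L ι₁) (h : exists_recordSystem) (h4 : 4 ≤ Module.finrank ℚ L)
    (Φ : CMType (pkgF L)) (iso : ℕ → Prop) :
    letI : Algebra (L : Type) ℂ := ι₁.toAlgebra
    ComponentAlbaneseId hHD hI hU h₃ hA V h Φ (sec42DataIdOfFourLe h (pkgV V) Φ h4 iso)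
      (sec42DataIdOfFourLe_heckeTranslates hU7 h (pkgV V) Φ h4 iso) := by
  letI : Algebra (L : Type) ℂ := ι₁.toAlgebra
  exact
    { Γof := levelOf V
      belowConjThree := belowConjThree_levelOf V
      Γof_mono := fun hle => levelOf_mono V hle
      Γof_hecke := fun _ _ _ hle => levelOf_le_conj_of_heckeLE V hle
      alb := fun K hh =>
        haveI := geometricallyIrreducible_pms hU h₃ (code V K hh)
        albOnPiece ((sec42DataIdOfFourLe h (pkgV V) Φ h4 iso).alb K) (componentInjId V hU h₃ h4 h hHD K hh) (basePt V hU h₃ K hh)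
      pull_alb_rel := fun K _ _ _ r => by
        rw [HodgeCM.Model.universeOf_pull]
        exact pull_albOnPiece_componentInjId_rel V hU h₃ h4 h hHD hA Φ iso K r 1
      pull_alb_Atr := fun f hh => by
        rw [HodgeCM.Model.universeOf_pull]
        exact pull_albOnPiece_componentInjId_Atr V hU h₃ h4 h hHD hA Φ iso f hh 1
      pull_alb_albTr := fun g _ _ hK hh => by
        rw [HodgeCM.Model.universeOf_pull]
        exact pull_albOnPiece_componentInjId_albTr V hU h₃ h4 h hHD hA hU7 Φ iso g hK hh 1
      alb_detect := fun K _ φ hφ => exists_pull_albOnPiece_componentInjId_ne_zero V hU h₃ h4 h hHD Φ iso K φ hφ }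

/-- Its level dictionary is `levelOf V` (by `rfl`). [cite: Liu2021, Prop. C.5 l. 4627–4628] -/
@[simp] theorem componentAlbanesePinId_Γof (hHD : exists_isReal_hodgeModel) (hI : hodgePQ_independent_of_hodgeModel)
    (hU : BallQuotientUniformisedDatum) (h₃ : CMAbelianVarietyRealised) (hA : Arapura2012_Cor_15_4_6)
    (hU7 : heckeTranslate_definedOver) (V : HodgeCM.HermSpace3 L ι₁) (h : exists_recordSystem) (h4 : 4 ≤ Module.finrank ℚ L)
    (Φ : CMType (pkgF L)) (iso : ℕ → Prop)
    (K₁ : C5.SmallLevel (K3 (pkgV V))) :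
    letI : Algebra (L : Type) ℂ := ι₁.toAlgebra
    (componentAlbanesePinId hHD hI hU h₃ hA hU7 V h h4 Φ iso).Γof K₁ = levelOf V K₁ := rfl

/-- **The level law `hΓ` at the explicit carrier**: `(J.Γof K₁).K = K₁` (prove-3's binder, token for token). [cite: Liu2021, Prop. C.5 l. 4627–4628] -/
theorem componentAlbanesePinId_levelLaw (hHD : exists_isReal_hodgeModel) (hI : hodgePQ_independent_of_hodgeModel)
    (hU : BallQuotientUniformisedDatum) (h₃ : CMAbelianVarietyRealised) (hA : Arapura2012_Cor_15_4_6)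
    (hU7 : heckeTranslate_definedOver) (V : HodgeCM.HermSpace3 L ι₁) (h : exists_recordSystem) (h4 : 4 ≤ Module.finrank ℚ L)
    (Φ : CMType (pkgF L)) (iso : ℕ → Prop)
    (K₁ : C5.SmallLevel (sec42DataIdOfFourLe h (pkgV V) Φ h4 iso).S.K₀) :
    letI : Algebra (L : Type) ℂ := ι₁.toAlgebra
    (((componentAlbanesePinId hHD hI hU h₃ hA hU7 V h h4 Φ iso).Γof K₁).K : Subgroup ↥V.adelicFin) =
      (K₁.1 : Subgroup (sec42DataIdOfFourLe h (pkgV V) Φ h4 iso).G) := rfl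

/-- **The J2 interface value AS A TERM at the TOTAL carrier** `Model.sec42DataIdOf h iso …` ∕ `Model.sec42DataIdOf_heckeTranslates`
(`ComponentAlbanese.transport` along `Model.sec42DataIdOf_eq_of_four_le`). [cite: Liu2021, §4.2 l. 2053–2074] -/
def componentAlbanesePinTotalId (hHD : exists_isReal_hodgeModel) (hI : hodgePQ_independent_of_hodgeModel)
    (hU : BallQuotientUniformisedDatum) (h₃ : CMAbelianVarietyRealised) (hA : Arapura2012_Cor_15_4_6)
    (hU7 : heckeTranslate_definedOver) (V : HodgeCM.HermSpace3 L ι₁) (h : exists_recordSystem) (h4 : 4 ≤ Module.finrank ℚ L)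
    (Φ : CMType (pkgF L))
    (iso : ∀ (F : Summit.HodgeConjecture.CorCM.CMField) (ι : F →+* ℂ) (_ : Summit.HodgeConjecture.CorCM.HermSpace3 F ι)
      (_ : CMType F), ℕ → Prop) :
    letI : Algebra (L : Type) ℂ := ι₁.toAlgebra
    ComponentAlbaneseId hHD hI hU h₃ hA V h Φ (sec42DataIdOf h iso (pkgF L) ι₁ (pkgV V) Φ)
      (sec42DataIdOf_heckeTranslates hU7 h (pkgV V) Φ iso h4) := by
  letI : Algebra (L : Type) ℂ := ι₁.toAlgebra
  exact (componentAlbanesePinId hHD hI hU h₃ hA hU7 V h h4 Φ (iso (pkgF L) ι₁ (pkgV V) Φ)).transport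
    (sec42DataIdOf_eq_of_four_le h (pkgV V) Φ iso h4).symm

/-- **The level law `hΓ` at the TOTAL carrier**: `(J.Γof K₁).K = K₁` for `J := componentAlbanesePinTotalId …`. [cite: Liu2021, Prop. C.5 l. 4627–4628] -/
theorem componentAlbanesePinTotalId_levelLaw (hHD : exists_isReal_hodgeModel) (hI : hodgePQ_independent_of_hodgeModel)
    (hU : BallQuotientUniformisedDatum) (h₃ : CMAbelianVarietyRealised) (hA : Arapura2012_Cor_15_4_6)
    (hU7 : heckeTranslate_definedOver) (V : HodgeCM.HermSpace3 L ι₁) (h : exists_recordSystem) (h4 : 4 ≤ Module.finrank ℚ L)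
    (Φ : CMType (pkgF L))
    (iso : ∀ (F : Summit.HodgeConjecture.CorCM.CMField) (ι : F →+* ℂ) (_ : Summit.HodgeConjecture.CorCM.HermSpace3 F ι)
      (_ : CMType F), ℕ → Prop)
    (K₁ : C5.SmallLevel (sec42DataIdOf h iso (pkgF L) ι₁ (pkgV V) Φ).S.K₀) :
    letI : Algebra (L : Type) ℂ := ι₁.toAlgebra
    (((componentAlbanesePinTotalId hHD hI hU h₃ hA hU7 V h h4 Φ iso).Γof K₁).K : Subgroup ↥V.adelicFin) =
      (K₁.1 : Subgroup (sec42DataIdOf h iso (pkgF L) ι₁ (pkgV V) Φ).G) := by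
  letI : Algebra (L : Type) ℂ := ι₁.toAlgebra
  have key : ∀ {C' : Sec42Data (honestP5IdOf h (pkgF L) ι₁ (pkgV V) Φ) (iso (pkgF L) ι₁ (pkgV V) Φ)}
      (e : sec42DataIdOfFourLe h (pkgV V) Φ h4 (iso (pkgF L) ι₁ (pkgV V) Φ) = C') (K' : C5.SmallLevel C'.S.K₀),
      ((((componentAlbanesePinId hHD hI hU h₃ hA hU7 V h h4 Φ (iso (pkgF L) ι₁ (pkgV V) Φ)).transport e).Γof K').K :
        Subgroup ↥V.adelicFin) = (K'.1 : Subgroup C'.G) := by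
    intro C' e K'
    subst e
    rfl
  exact key (sec42DataIdOf_eq_of_four_le h (pkgV V) Φ iso h4).symm K₁

/-- `∃ J, levelLaw J` at the explicit carrier (the shape wb-4's ∕ prove-3's assembly consumes). [cite: Liu2021, §4.2 l. 2062–2074 and Prop. C.5] -/
theorem exists_componentAlbanesePinId_levelLaw (hHD : exists_isReal_hodgeModel) (hI : hodgePQ_independent_of_hodgeModel)
    (hU : BallQuotientUniformisedDatum) (h₃ : CMAbelianVarietyRealised) (hA : Arapura2012_Cor_15_4_6)
    (hU7 : heckeTranslate_definedOver) (V : HodgeCM.HermSpace3 L ι₁) (h : exists_recordSystem) (h4 : 4 ≤ Module.finrank ℚ L)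
    (Φ : CMType (pkgF L)) (iso : ℕ → Prop) :
    letI : Algebra (L : Type) ℂ := ι₁.toAlgebra
    ∃ J : ComponentAlbaneseId hHD hI hU h₃ hA V h Φ (sec42DataIdOfFourLe h (pkgV V) Φ h4 iso)
        (sec42DataIdOfFourLe_heckeTranslates hU7 h (pkgV V) Φ h4 iso),
      ∀ K₁ : C5.SmallLevel (sec42DataIdOfFourLe h (pkgV V) Φ h4 iso).S.K₀,
        ((J.Γof K₁).K : Subgroup ↥V.adelicFin) = (K₁.1 : Subgroup (sec42DataIdOfFourLe h (pkgV V) Φ h4 iso).G) := by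
  letI : Algebra (L : Type) ℂ := ι₁.toAlgebra
  exact ⟨componentAlbanesePinId hHD hI hU h₃ hA hU7 V h h4 Φ iso, fun _ => rfl⟩

/-- `∃ J, levelLaw J` at the TOTAL carrier `Model.sec42DataIdOf ∕ sec42DataIdOf_heckeTranslates` — the J-socket of the (c)(d) assembly BY VALUE
at the instance `algebraMap L ℂ = ῑ₁`. [cite: Liu2021, §4.2 l. 2053–2074 and Prop. C.5] -/
theorem exists_componentAlbanesePinTotalId_levelLaw (hHD : exists_isReal_hodgeModel) (hI : hodgePQ_independent_of_hodgeModel)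
    (hU : BallQuotientUniformisedDatum) (h₃ : CMAbelianVarietyRealised) (hA : Arapura2012_Cor_15_4_6)
    (hU7 : heckeTranslate_definedOver) (V : HodgeCM.HermSpace3 L ι₁) (h : exists_recordSystem) (h4 : 4 ≤ Module.finrank ℚ L)
    (Φ : CMType (pkgF L))
    (iso : ∀ (F : Summit.HodgeConjecture.CorCM.CMField) (ι : F →+* ℂ) (_ : Summit.HodgeConjecture.CorCM.HermSpace3 F ι)
      (_ : CMType F), ℕ → Prop) :
    letI : Algebra (L : Type) ℂ := ι₁.toAlgebra
    ∃ J : ComponentAlbaneseId hHD hI hU h₃ hA V h Φ (sec42DataIdOf h iso (pkgF L) ι₁ (pkgV V) Φ)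
        (sec42DataIdOf_heckeTranslates hU7 h (pkgV V) Φ iso h4),
      ∀ K₁ : C5.SmallLevel (sec42DataIdOf h iso (pkgF L) ι₁ (pkgV V) Φ).S.K₀,
        ((J.Γof K₁).K : Subgroup ↥V.adelicFin) = (K₁.1 : Subgroup (sec42DataIdOf h iso (pkgF L) ι₁ (pkgV V) Φ).G) := by
  letI : Algebra (L : Type) ℂ := ι₁.toAlgebra
  exact ⟨componentAlbanesePinTotalId hHD hI hU h₃ hA hU7 V h h4 Φ iso,
    componentAlbanesePinTotalId_levelLaw hHD hI hU h₃ hA hU7 V h h4 Φ iso⟩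


end Summit.HodgeConjecture.CorCM.D2Bridge.Iota1

end
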